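import Summits.Ventures.PercRepro.ClassHarris
import Summits.Ventures.PercRepro.C026CutVertexB3
import Summits.Ventures.PercRepro.C026CutVertexB5

/-!
# mine-3's Theorem P (a) and Corollary B (i): (CF) composes over a cut vertex separating `b` (p5, gen 15)

mine-3 (`proofs/MINE3-MONOTONICITY.md` §24, Theorem P (a)): for marks `a, c` and every vertex `x`,
`#{S : a ~_S x, c ~_{S̄} x} ≤ #{S : a ~_S c}` — Harris' inequality in its antipodal counting form
(typer-2's `card_inter_compl_le_card_inter`, Kleitman: `#{ω ∈ A, ωᶜ ∈ B} ≤ #(A ∩ B)` for increasing `A, B`) with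
`A = {a ~ x}`, `B = {c ~ x}`, and `A ∩ B ⊆ {a ~ c}` (**`card_conn_conn_compl_le`**). Hence `#P_v ≤ #{a ~ c}`
(`card_pv_le`) and, with Theorem B (B3) and `p ≤ t`, Corollary B (i): `Δ_CF(G) ≥ u·Δ_CF(G₁; a, v, c) + (t − p)·Y`
(**`slackCF_cut_b_ge`**) — **C-026 on the `a, c`-side implies C-026 on `G`** when a non-mark cut vertex
separates `b` from `a, c` (**`slackCF_nonneg_of_cut_b`**).
-/

namespace PercRepro

open Finset

namespace MultiGraph

section TheoremP

variable {V E : Type*} {G : MultiGraph V E}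

open Classical in
/-- **Theorem P (a)** (mine-3 §24): `#{S : a ~_S x, c ~_{S̄} x} ≤ #{S : a ~_S c}` — Harris (antipodal form) for
the increasing events `{a ~ x}` and `{c ~ x}`, then `a ~ x ~ c`. -/
theorem card_conn_conn_compl_le [Fintype E] (a c x : V) :
    (univ.filter fun ω : Config E => G.Conn ω a x ∧ G.Conn ωᶜ c x).card ≤
      (univ.filter fun ω : Config E => G.Conn ω a c).card := by
  have h1 : (univ.filter fun ω : Config E => G.Conn ω a x ∧ G.Conn ωᶜ c x).card ≤
      (univ.filter fun ω : Config E => G.Conn ω a x ∧ G.Conn ω c x).card := by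
    have := card_inter_compl_le_card_inter (G.connEvent a x) (G.connEvent c x)
      (G.isUpperSet_connEvent a x) (G.isUpperSet_connEvent c x)
    convert this using 4 <;> rfl
  refine le_trans h1 (Finset.card_le_card ?_)
  intro ω hω
  simp only [Finset.mem_filter, Finset.mem_univ, true_and] at hω ⊢
  exact hω.1.trans hω.2.symm

open Classical in
/-- `#P_v ≤ #{a ~ c}` (`P_v = {a ~ v, c ~̄ v, c ≁̄ a}`), in the orientation of Theorem B (B3). -/
theorem card_pv_le [Fintype E] (a c v : V) :
    (univ.filter fun ω : Config E => G.Conn ω a v ∧ G.Conn ωᶜ c v ∧ ¬ G.Conn ωᶜ c a).card ≤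
      (univ.filter fun ω : Config E => G.Conn ω c a).card := by
  refine le_trans (Finset.card_le_card ?_)
    (le_trans (card_conn_conn_compl_le (G := G) a c v) (le_of_eq ?_))
  · intro ω hω
    simp only [Finset.mem_filter, Finset.mem_univ, true_and] at hω ⊢
    exact ⟨hω.1, hω.2.1⟩
  · exact congrArg Finset.card (Finset.filter_congr fun ω _ => conn_comm)

open Classical in
/-- **Corollary B (i)** (mine-3 §1): `Δ_CF(G) ≥ u·Δ_CF(G₁; a, v, c) + (t − p)·Y` for a cut vertex `v ∉ {a, b, c}`
separating `b` from `a, c` (`#P_v ≤ Y` by Theorem P, `p ≤ t` by complement symmetry). -/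
theorem slackCF_cut_b_ge [Fintype E] {v : V} {side : E → Bool} (hg : G.IsGluing v v v side) {a b c : V}
    (ha : G.OnSide side true a) (hb : G.OnSide side false b) (hc : G.OnSide side true c)
    (hab : a ≠ b) (hcb : c ≠ b) :
    ((univ.filter fun ω₂ : Config {e // side e = false} => (G.part side false).Conn ω₂ v b).card : ℤ) *
          (G.part side true).slackCF a v c +
        (((univ.filter fun ω₂ : Config {e // side e = false} =>
            ¬ (G.part side false).Conn ω₂ v b).card : ℤ) -
          ((univ.filter fun ω₂ : Config {e // side e = false} =>
            (G.part side false).Conn ω₂ v b ∧ ¬ (G.part side false).Conn ω₂ᶜ v b).card : ℤ)) *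
          ((univ.filter fun ω₁ : Config {e // side e = true} => (G.part side true).Conn ω₁ c a).card : ℤ) ≤
      G.slackCF a b c := by
  rw [slackCF_cut_b hg ha hb hc hab hcb]
  have hP : (univ.filter fun ω₁ : Config {e // side e = true} =>
      (G.part side true).Conn ω₁ a v ∧ (G.part side true).Conn ω₁ᶜ c v ∧
        ¬ (G.part side true).Conn ω₁ᶜ c a).card ≤
      (univ.filter fun ω₁ : Config {e // side e = true} => (G.part side true).Conn ω₁ c a).card := by
    convert card_pv_le (G := G.part side true) a c v using 4
  have hp : (univ.filter fun ω₂ : Config {e // side e = false} =>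
      (G.part side false).Conn ω₂ v b ∧ ¬ (G.part side false).Conn ω₂ᶜ v b).card ≤
      (univ.filter fun ω₂ : Config {e // side e = false} => ¬ (G.part side false).Conn ω₂ v b).card := by
    convert card_conn_not_compl_le (G.part side false) v b using 4
  have h1 := Nat.mul_le_mul_left
    (univ.filter fun ω₂ : Config {e // side e = false} =>
      (G.part side false).Conn ω₂ v b ∧ ¬ (G.part side false).Conn ω₂ᶜ v b).card hP
  have h2 := Nat.cast_le (α := ℤ) |>.mpr hp
  have h3 := Nat.cast_le (α := ℤ) |>.mpr h1
  push_cast at h3 ⊢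
  nlinarith [Nat.cast_nonneg (α := ℤ) (univ.filter fun ω₁ : Config {e // side e = true} =>
    (G.part side true).Conn ω₁ c a).card, Nat.cast_nonneg (α := ℤ)
    (univ.filter fun ω₂ : Config {e // side e = false} =>
      (G.part side false).Conn ω₂ v b ∧ ¬ (G.part side false).Conn ω₂ᶜ v b).card]

open Classical in
/-- **C-026 composes over a cut vertex separating `b` from `a, c`**: (CF) on the `a, c`-side with `v` as the
mark `b` gives (CF) on `G`. -/
theorem slackCF_nonneg_of_cut_b [Fintype E] {v : V} {side : E → Bool} (hg : G.IsGluing v v v side)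
    {a b c : V} (ha : G.OnSide side true a) (hb : G.OnSide side false b) (hc : G.OnSide side true c)
    (hab : a ≠ b) (hcb : c ≠ b) (h₁ : 0 ≤ (G.part side true).slackCF a v c) :
    0 ≤ G.slackCF a b c := by
  refine le_trans ?_ (slackCF_cut_b_ge hg ha hb hc hab hcb)
  have hp : (univ.filter fun ω₂ : Config {e // side e = false} =>
      (G.part side false).Conn ω₂ v b ∧ ¬ (G.part side false).Conn ω₂ᶜ v b).card ≤
      (univ.filter fun ω₂ : Config {e // side e = false} => ¬ (G.part side false).Conn ω₂ v b).card := by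
    convert card_conn_not_compl_le (G.part side false) v b using 4
  have h2 : (0 : ℤ) ≤ ((univ.filter fun ω₂ : Config {e // side e = false} =>
      ¬ (G.part side false).Conn ω₂ v b).card : ℤ) -
      ((univ.filter fun ω₂ : Config {e // side e = false} =>
        (G.part side false).Conn ω₂ v b ∧ ¬ (G.part side false).Conn ω₂ᶜ v b).card : ℤ) := by
    have := Nat.cast_le (α := ℤ) |>.mpr hp
    linarith
  exact add_nonneg (mul_nonneg (Nat.cast_nonneg _) h₁) (mul_nonneg h2 (Nat.cast_nonneg _))

end TheoremP

end MultiGraph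

end PercRepro
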